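import Literature.Computability.AlgebraicComplexity.JointCircuits
import Literature.Computability.AlgebraicComplexity.NonscalarBaurStrassen
import Literature.Computability.AlgebraicComplexity.LaurentPolyOrder
import HarnessLib

/-!
# VP-boundary square — roots toolbox (road E1, stage 2, series S1 of O-L3-12)

Decomp lens-3 (border axis), g36; route `route-ValiantsHypothesis-VPBoundarySquare`, census road
E1 `RootsPresentable` (BDS 2024 Lemma 4.4, root form). GENERIC tools (no `H`, no `φ`) consumed by
the presentable root theorem (series S2/S3); 0 new definitions.

§1 **Nonscalar cost prices back into `complexity`; Baur–Strassen, degree-free.** The tree has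
Baur–Strassen in the NONSCALAR model (`exists_isNonscalarSeq_forall_pderiv`) and in its own
straight-line model (`TotalBaurStrassen`, whose docstring records that the translation to
`ArithCircuit.complexity` is not carried out); the derivative costs stated in the `complexity`
currency (`RootLifting`, `GKSS19DerivativeCost`) are priced by the DEGREE. Here a nonscalar
sequence of length `m` in `n` variables is realised as ONE fan-in-two gate list (`JointlyComputed`,
Bürgisser 2000 Rem. 2.7) of length `≤ m (4 (n + m) + 3)` — each step `g = u · v` appends the two
affine forms `u, v` (`≤ 2 (n + m) + 1` gates each: the quadratic price of re-expanding cost-free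
linear combinations in fan-in two) and one product gate — whence `L(p) ≤ 4 (m + n + 1)²` on the
cost-free span (BCS 1997 (4.7), explicit) and ★★ `complexity_pderiv_le : L(∂ᵢ f) ≤
4 (3 L(f) + n + 1)²`, coarse (printed: `4 L`, BCS 1997 Rem. (7.8)(1)) but DEGREE-FREE.

§2 **Pole calculus in `F((ε))[x]`**: powers / polynomial images of `O(ε^{-p})` polynomials, units
of `F[[ε]]`, poles of slow-Newton iterates `z ↦ z - s · P(z)`, `s = O(ε^{-e})`: `O(ε^{-e (D+1)^r})`.

§3 **Lagrange rescaling in `ε` replaces truncation**: nodes `t_j = λ_j ε^m` (`λ` injective,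
`j = 0..d`), weights `ℓ_j = Π_{i ≠ j} (1 - t_i)/(t_j - t_i)` (Lagrange basis at `1`):
`Σ_j ℓ_j t_j^i = 1` (`i ≤ d`) and `ℓ_j t_j^N = O(ε^{m (N - d)})`, so for `z = O(ε^{-p})`, `m > p`:
`Σ_j ℓ_j · z(t_j x) = trunc_d z + O(ε)` — truncation as an `ε`-analytic identity with `d + 1`
rescaled copies and `2d + 2` RATIONAL `ε`-constants.
-/

noncomputable section
set_option linter.dupNamespace false
open MvPolynomial Finset
open Literature.Computability.AlgebraicComplexity
open Literature.Computability.AlgebraicComplexity.ArithCircuit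

namespace Summit.ValiantsHypothesis.ValiantsHypothesis.Theorems.VPBoundarySquareRootsToolbox
universe u v w

/-! ## §1 — nonscalar sequences price back into `complexity`; Baur–Strassen, degree-free -/

section Pricing
variable {k : Type u} [CommSemiring k] {σ : Type v} [Fintype σ]

/-- Elements of the cost-free span of a finite family `v` are affine-linear combinations of `1`,
the variables and the `v i`. [cite: BurgisserClausenShokrollahi1997, §4.1] -/
theorem exists_affine_repr_of_mem_freeSpan {ι : Type w} [Fintype ι] (v : ι → MvPolynomial σ k)
    {u : MvPolynomial σ k} (hu : u ∈ freeSpan (Set.range v)) :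
    ∃ (c : k) (a : σ ⊕ ι → k), u = C c + ∑ y, a y • Sum.elim X v y := by
  classical
  induction hu using Submodule.span_induction with
  | mem x hx =>
    rcases hx with rfl | ⟨i, rfl⟩ | ⟨j, rfl⟩
    · exact ⟨1, fun _ => 0, by simp⟩
    · refine ⟨0, fun y => if y = Sum.inl i then 1 else 0, ?_⟩
      simp [ite_smul, Finset.sum_ite_eq']
    · refine ⟨0, fun y => if y = Sum.inr j then 1 else 0, ?_⟩
      simp [ite_smul, Finset.sum_ite_eq']
  | zero => exact ⟨0, fun _ => 0, by simp⟩
  | add x y _ _ hx hy =>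
    obtain ⟨c₁, a₁, rfl⟩ := hx
    obtain ⟨c₂, a₂, rfl⟩ := hy
    refine ⟨c₁ + c₂, fun z => a₁ z + a₂ z, ?_⟩
    rw [map_add]
    simp_rw [add_smul, Finset.sum_add_distrib]
    ring
  | smul r x _ hx =>
    obtain ⟨c, a, rfl⟩ := hx
    refine ⟨r * c, fun z => r * a z, ?_⟩
    rw [smul_add, Finset.smul_sum, smul_eq_C_mul, ← map_mul]
    simp_rw [smul_smul]

/-- An affine-linear form in `N` variables costs `≤ 2 N + 1` fan-in-two gates.
[cite: Burgisser2000, Def. 2.1] -/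
theorem complexity_affine_le {ι : Type w} [Fintype ι] (c : k) (a : σ ⊕ ι → k) :
    complexity (C c + ∑ y, a y • (X y : MvPolynomial (σ ⊕ ι) k)) ≤
      2 * (Fintype.card σ + Fintype.card ι) + 1 := by
  have h0 : complexity (C c : MvPolynomial (σ ⊕ ι) k) = 0 := complexity_C_holds c
  have h1 := complexity_add_le_holds (C c : MvPolynomial (σ ⊕ ι) k)
    (∑ y, a y • (X y : MvPolynomial (σ ⊕ ι) k))
  have h2 := complexity_finset_sum_le (Finset.univ : Finset (σ ⊕ ι))
    (fun y => a y • (X y : MvPolynomial (σ ⊕ ι) k))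
  have h3 : ∑ y : σ ⊕ ι, complexity (a y • (X y : MvPolynomial (σ ⊕ ι) k)) ≤ ∑ _y : σ ⊕ ι, 1 :=
    Finset.sum_le_sum fun y _ => complexity_smul_X_le _ _
  simp only [Finset.sum_const, smul_eq_mul, mul_one, Finset.card_univ, Fintype.card_sum] at h3 h2
  omega

/-- **Appending a cost-free combination** of a jointly computed family `v` (in `n` variables,
`|ι|` members) costs `≤ 2 (n + |ι|) + 1` gates. [cite: Burgisser2000, Rem. 2.7] -/
theorem jointlyComputed_extend_freeSpan {ι : Type w} [Fintype ι] {v : ι → MvPolynomial σ k}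
    {s : ℕ} (h : JointlyComputed v s) {u : MvPolynomial σ k} (hu : u ∈ freeSpan (Set.range v)) :
    JointlyComputed (Sum.elim v fun _ : Unit => u)
      (s + (2 * (Fintype.card σ + Fintype.card ι) + 1)) := by
  obtain ⟨c, a, hu'⟩ := exists_affine_repr_of_mem_freeSpan v hu
  have h1 := h.extend₁ (C c + ∑ y, a y • (X y : MvPolynomial (σ ⊕ ι) k))
  have hev : aeval (Sum.elim X v) (C c + ∑ y, a y • (X y : MvPolynomial (σ ⊕ ι) k)) = u := by
    rw [hu']; simp only [map_add, map_sum, map_smul, aeval_C, aeval_X, MvPolynomial.algebraMap_eq]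
  rw [hev] at h1
  exact h1.mono (by have := complexity_affine_le (k := k) (σ := σ) c a; omega)

/-- The members of a list, as the range of `List.get`. [folklore] -/
theorem setOf_mem_eq_range_get {α : Type w} (l : List α) :
    {x | x ∈ l} = Set.range fun i : Fin l.length => l.get i :=
  Set.ext fun _ => List.mem_iff_get

/-- **A nonscalar computation sequence of length `m` in `n` variables is jointly computed by
`≤ m (4 (n + m) + 3)` fan-in-two gates** (each step: two affine forms and one product).
[cite: BurgisserClausenShokrollahi1997, (4.7) and Rem. (7.8)(1); Burgisser2000, Rem. 2.7] -/
theorem isNonscalarSeq_jointlyComputed {gs : List (MvPolynomial σ k)} (hgs : IsNonscalarSeq gs) :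
    JointlyComputed (fun i : Fin gs.length => gs.get i)
      (gs.length * (4 * (Fintype.card σ + gs.length) + 3)) := by
  induction gs with
  | nil => exact (jointlyComputed_of_inputs _ fun i => i.elim0).mono (Nat.zero_le _)
  | cons g rest ih =>
    rw [isNonscalarSeq_cons] at hgs
    obtain ⟨hrest, u, hu, w, hw, hg⟩ := hgs
    have ih' := ih hrest
    rw [setOf_mem_eq_range_get] at hu hw
    have h1 := jointlyComputed_extend_freeSpan ih' hu
    have hw' : w ∈ freeSpan (Set.range
        (Sum.elim (fun i : Fin rest.length => rest.get i) fun _ : Unit => u)) :=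
      freeSpan_mono (by rintro x ⟨i, rfl⟩; exact ⟨Sum.inl i, rfl⟩) hw
    have h2 := jointlyComputed_extend_freeSpan h1 hw'
    have h3 := h2.extend_mul (κ := Unit) (fun _ => Sum.inl (Sum.inr ())) (fun _ => Sum.inr ())
    refine (h3.of_mem (fun i : Fin (g :: rest).length => (g :: rest).get i) ?_).mono ?_
    · intro i
      refine Or.inl ?_
      obtain ⟨_ | j, hj⟩ := i
      · exact ⟨Sum.inr (), by simp [List.get_eq_getElem, hg]⟩
      · exact ⟨Sum.inl (Sum.inl (Sum.inl ⟨j, Nat.succ_lt_succ_iff.1 hj⟩)),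
          by simp [List.get_eq_getElem]⟩
    · simp only [Fintype.card_sum, Fintype.card_fin, Fintype.card_unit, List.length_cons]
      nlinarith [Nat.zero_le rest.length, Nat.zero_le (Fintype.card σ)]

/-- **Nonscalar cost prices back quadratically into total complexity**: every `p` in the
cost-free span of a nonscalar sequence of length `m` (in `n` variables) has
`L(p) ≤ 4 (m + n + 1)²`. [cite: BurgisserClausenShokrollahi1997, (4.7)] -/
theorem complexity_le_of_mem_freeSpan {gs : List (MvPolynomial σ k)} (hgs : IsNonscalarSeq gs)
    {p : MvPolynomial σ k} (hp : p ∈ freeSpan {x | x ∈ gs}) :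
    complexity p ≤ 4 * (gs.length + Fintype.card σ + 1) ^ 2 := by
  rw [setOf_mem_eq_range_get] at hp
  have h := jointlyComputed_extend_freeSpan (isNonscalarSeq_jointlyComputed hgs) hp
  have hc := h.complexity_le (Sum.inr ())
  simp only [Sum.elim_inr, Fintype.card_fin] at hc
  refine hc.trans ?_
  nlinarith [Nat.zero_le gs.length, Nat.zero_le (Fintype.card σ)]

/-- ★★ **Baur–Strassen in the tree's `complexity` currency, degree-free (coarse quadratic form):**
`L(∂ᵢ f) ≤ 4 (3 L(f) + n + 1)²` for every `f` in `n` variables over a commutative semiring (via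
`L ≥` nonscalar length, Baur–Strassen in the nonscalar model, and the re-pricing above; printed,
counting all operations: `4 · L` — the square is the fan-in-two re-expansion of the free affine
steps; independent of `deg f`). [cite: BaurStrassen1983, Thm. 1; BurgisserClausenShokrollahi1997, Thm. (7.7) and Rem. (7.8)(1)] -/
theorem complexity_pderiv_le (i : σ) (f : MvPolynomial σ k) :
    complexity (pderiv i f) ≤ 4 * (3 * complexity f + Fintype.card σ + 1) ^ 2 := by
  obtain ⟨gs, hgs, hlen, hmem⟩ :=
    exists_isNonscalarSeq_forall_pderiv (exists_isNonscalarSeq_length_le_complexity f)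
  refine (complexity_le_of_mem_freeSpan hgs (hmem i)).trans ?_
  have h : gs.length + Fintype.card σ + 1 ≤ 3 * complexity f + Fintype.card σ + 1 := by omega
  exact Nat.mul_le_mul_left 4 (Nat.pow_le_pow_left h 2)

end Pricing

/-! ## §2 — pole calculus in `F((ε))[x]` -/

section Poles
variable {F : Type u} [Field F] {σ : Type v}

/-- Powers: `x = O(ε^k) ⟹ x^N = O(ε^{N k})`. [folklore] -/
theorem isOrdGE_pow {k : ℤ} {x : LaurentSeries F} (hx : IsOrdGE k x) (N : ℕ) :
    IsOrdGE (N * k) (x ^ N) := by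
  induction N with
  | zero => simpa using IsOrdGE.one
  | succ N ih =>
    rw [pow_succ]
    convert ih.mul hx using 1
    push_cast
    ring

/-- Finite products: orders add. [folklore] -/
theorem isOrdGE_prod {ι : Type w} (s : Finset ι) {f : ι → LaurentSeries F} {k : ℤ}
    (h : ∀ i ∈ s, IsOrdGE k (f i)) : IsOrdGE (s.card * k) (∏ i ∈ s, f i) := by
  classical
  induction s using Finset.induction_on with
  | empty => simpa using IsOrdGE.one
  | insert a s ha ih =>
    rw [Finset.prod_insert ha, Finset.card_insert_of_notMem ha]
    convert (h a (Finset.mem_insert_self a s)).mul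
      (ih fun i hi => h i (Finset.mem_insert_of_mem hi)) using 1
    push_cast
    ring

/-- **A power series with nonzero constant term is a unit of `F[[ε]]`**: `x = O(1)`, `x(0) ≠ 0`
`⟹ x⁻¹ = O(1)`. [folklore] -/
theorem isOrdGE_zero_inv {x : LaurentSeries F} (hx : IsOrdGE 0 x) (h0 : x.coeff 0 ≠ 0) :
    IsOrdGE 0 x⁻¹ := by
  have hx0 : x ≠ 0 := fun h => h0 (by rw [h, HahnSeries.coeff_zero])
  have hord : x.order = 0 := by
    refine le_antisymm (HahnSeries.order_le_of_coeff_ne_zero h0) ?_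
    by_contra hlt
    push Not at hlt
    exact (HahnSeries.coeff_order_eq_zero (x := x)).not.2 hx0 (hx _ hlt)
  set φ := LaurentSeries.powerSeriesPart x with hφ
  have hxφ : x = HahnSeries.ofPowerSeries ℤ F φ := by
    have := LaurentSeries.single_order_mul_powerSeriesPart x
    rw [hord] at this
    rw [← this]
    change HahnSeries.single 0 (1 : F) * _ = _
    rw [HahnSeries.single_zero_one, one_mul]
  have hφ0 : PowerSeries.constantCoeff φ ≠ 0 := by
    rw [← PowerSeries.coeff_zero_eq_constantCoeff_apply, hφ, LaurentSeries.powerSeriesPart_coeff,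
      hord, zero_add]
    exact h0
  have hinv : x⁻¹ = HahnSeries.ofPowerSeries ℤ F φ⁻¹ := by
    refine inv_eq_of_mul_eq_one_right ?_
    rw [hxφ, ← map_mul, PowerSeries.mul_inv_cancel φ hφ0, map_one]
  rw [hinv]
  exact IsOrdGE.ofPowerSeries _

/-- Poles of powers: `z = O(ε^{-p})` coefficientwise `⟹ z^i = O(ε^{-i p})`. [folklore] -/
theorem polyOrdGE_pow_of_neg {p : ℕ} {z : MvPolynomial σ (LaurentSeries F)}
    (hz : PolyOrdGE (-(p : ℤ)) z) (i : ℕ) : PolyOrdGE (-((i * p : ℕ) : ℤ)) (z ^ i) := by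
  induction i with
  | zero => simpa using PolyOrdGE.one
  | succ i ih =>
    rw [pow_succ]
    convert ih.mul hz using 1
    push_cast
    ring

/-- `O(1)` coefficients, degree `≤ D`, argument `O(ε^{-p})` `⟹` value `O(ε^{-D p})`.
[folklore] -/
theorem polyOrdGE_polynomial_eval {P : Polynomial (MvPolynomial σ (LaurentSeries F))}
    (hP : ∀ i, PolyOrdGE 0 (P.coeff i)) {D : ℕ} (hD : P.natDegree ≤ D)
    {p : ℕ} {z : MvPolynomial σ (LaurentSeries F)} (hz : PolyOrdGE (-(p : ℤ)) z) :
    PolyOrdGE (-((D * p : ℕ) : ℤ)) (P.eval z) := by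
  rw [Polynomial.eval_eq_sum_range]
  refine PolyOrdGE.sum fun i hi => ?_
  have hi' : i ≤ D := by have := Finset.mem_range.1 hi; omega
  refine PolyOrdGE.mono ?_ ((hP i).mul (polyOrdGE_pow_of_neg hz i))
  have : ((i * p : ℕ) : ℤ) ≤ ((D * p : ℕ) : ℤ) := by exact_mod_cast Nat.mul_le_mul_right p hi'
  linarith

/-- Truncations keep `O(ε^k)` coefficients. [folklore] -/
theorem polyOrdGE_truncation {k : ℤ} {p : MvPolynomial σ (LaurentSeries F)}
    (hp : PolyOrdGE k p) (D : ℕ) :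
    PolyOrdGE k (∑ i ∈ range (D + 1), homogeneousComponent i p) := by
  classical
  refine PolyOrdGE.sum fun i _ => fun m => ?_
  rw [coeff_homogeneousComponent]
  split_ifs
  · exact hp m
  · exact IsOrdGE.zero k

/-- **Poles of slow-Newton iterates.** If `P` has `O(1)` coefficients and degree `≤ D`, the
slope `s` is `O(ε^{-e})` and the start `c` is `O(1)`, then the `r`-th iterate of
`z ↦ z - s · P(z)` is `O(ε^{-e (D+1)^r})` coefficientwise (`p_{r+1} = e + D p_r`). [folklore] -/
theorem polyOrdGE_newton_iterate_pole
    {P : Polynomial (MvPolynomial σ (LaurentSeries F))} (hP : ∀ i, PolyOrdGE 0 (P.coeff i))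
    {D : ℕ} (hD : P.natDegree ≤ D) {e : ℕ} {s : LaurentSeries F}
    (hs : IsOrdGE (-(e : ℤ)) s) {c : LaurentSeries F} (hc : IsOrdGE 0 c) (r : ℕ) :
    PolyOrdGE (-((e * (D + 1) ^ r : ℕ) : ℤ)) ((fun z => z - C s * P.eval z)^[r] (C c)) := by
  induction r with
  | zero =>
    simp only [Function.iterate_zero, id_eq, pow_zero, mul_one]
    exact (PolyOrdGE.C hc).mono (by omega)
  | succ r ih =>
    rw [Function.iterate_succ_apply']
    have hmono : e * (D + 1) ^ r ≤ e * (D + 1) ^ (r + 1) :=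
      Nat.mul_le_mul_left _ (Nat.pow_le_pow_right (Nat.succ_pos D) (Nat.le_succ r))
    have key : e + D * (e * (D + 1) ^ r) ≤ e * (D + 1) ^ (r + 1) := by
      have h1 : 1 ≤ (D + 1) ^ r := Nat.one_le_pow _ _ (Nat.succ_pos D)
      calc e + D * (e * (D + 1) ^ r) ≤ e * (D + 1) ^ r + D * (e * (D + 1) ^ r) := by nlinarith
        _ = e * (D + 1) ^ (r + 1) := by ring
    refine PolyOrdGE.sub (ih.mono ?_)
      (((PolyOrdGE.C hs).mul (polyOrdGE_polynomial_eval hP hD ih)).mono ?_)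
    · have := (Int.ofNat_le).2 hmono
      linarith
    · have := (Int.ofNat_le).2 key
      push_cast at this ⊢
      linarith

end Poles

/-! ## §3 — Lagrange rescaling in `ε` replaces truncation -/

section Lagrange
variable {F : Type u} [Field F] {σ : Type v}

/-- Rescaling `x ↦ t x` multiplies the coefficient of `x^n` by `t^{|n|}`. [folklore] -/
theorem coeff_aeval_C_mul_X {K : Type u} [CommSemiring K] (t : K)
    (z : MvPolynomial σ K) (n : σ →₀ ℕ) :
    coeff n (aeval (fun b : σ => C t * X b) z) = t ^ n.degree * coeff n z := by
  classical
  induction z using MvPolynomial.induction_on' with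
  | monomial m a =>
    have hprod : (∏ i ∈ m.support, (C t * X i : MvPolynomial σ K) ^ m i) =
        C (t ^ m.degree) * monomial m 1 := by
      rw [monomial_eq, C_1, one_mul, Finsupp.degree_apply]
      simp only [Finsupp.prod]
      simp_rw [mul_pow, Finset.prod_mul_distrib, ← map_pow, ← map_prod,
        Finset.prod_pow_eq_pow_sum]
    simp only [aeval_monomial, Finsupp.prod, MvPolynomial.algebraMap_eq]
    rw [hprod, ← mul_assoc, ← map_mul, C_mul_monomial, mul_one, coeff_monomial, coeff_monomial]
    split_ifs with h
    · subst h; ring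
    · rw [mul_zero]
  | add p q hp hq => rw [map_add, coeff_add, coeff_add, hp, hq, mul_add]

/-- **The Lagrange weights at `1` reproduce low powers**: for injective nodes `t_0, …, t_d` and
`ℓ_j = Π_{i ≠ j} (1 - t_i)/(t_j - t_i)`, `Σ_j ℓ_j t_j^i = 1` for every `i ≤ d` (interpolation of
`X^i` at the nodes, evaluated at `1`). [folklore] -/
theorem sum_lagrangeWeight_mul_pow {K : Type u} [Field K] {d : ℕ} {t : Fin (d + 1) → K}
    (ht : Function.Injective t) {ℓ : Fin (d + 1) → K}
    (hℓ : ∀ j, ℓ j = ∏ i ∈ univ.erase j, (1 - t i) / (t j - t i)) {i : ℕ} (hi : i ≤ d) :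
    ∑ j, ℓ j * t j ^ i = 1 := by
  classical
  have hinj : Set.InjOn t (↑(Finset.univ : Finset (Fin (d + 1)))) := ht.injOn
  have hdeg : (Polynomial.X ^ i : Polynomial K).degree < #(Finset.univ : Finset (Fin (d + 1))) := by
    rw [Polynomial.degree_X_pow, Finset.card_univ, Fintype.card_fin]
    exact_mod_cast Nat.lt_succ_of_le hi
  have h := Lagrange.eq_interpolate (f := (Polynomial.X ^ i : Polynomial K)) hinj hdeg
  have h1 := congrArg (Polynomial.eval (1 : K)) h
  rw [Polynomial.eval_pow, Polynomial.eval_X, one_pow, Lagrange.interpolate_apply,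
    Polynomial.eval_finsetSum] at h1
  calc ∑ j, ℓ j * t j ^ i
      = ∑ j, Polynomial.eval 1 (Polynomial.C (Polynomial.eval (t j) (Polynomial.X ^ i)) *
          Lagrange.basis Finset.univ t j) := Finset.sum_congr rfl fun j _ => ?_
    _ = 1 := h1.symm
  rw [Polynomial.eval_mul, Polynomial.eval_C, Polynomial.eval_pow, Polynomial.eval_X, mul_comm,
    hℓ j]
  congr 1
  unfold Lagrange.basis
  rw [Polynomial.eval_prod]
  refine Finset.prod_congr rfl fun l _ => ?_
  rw [Lagrange.basisDivisor, Polynomial.eval_mul, Polynomial.eval_C, Polynomial.eval_sub,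
    Polynomial.eval_X, Polynomial.eval_C, div_eq_mul_inv, mul_comm]

/-- **Lagrange rescaling = truncation `+ O(ε)`.** Let `z ∈ F((ε))[x]` have `O(ε^{-p})`
coefficients, `m ≥ p + 1`, nodes `t_j = λ_j ε^m` (`λ : Fin (d+1) → F` injective) and weights
`ℓ_j = Π_{i ≠ j} (1 - t_i)/(t_j - t_i)`. Then `Σ_j ℓ_j · z(t_j x) = trunc_d z + O(ε)`
(coefficient of `x^n`: `(Σ_j ℓ_j t_j^{|n|}) z_n`; `= z_n` if `|n| ≤ d`, else order `≥ m - p`). [folklore] -/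
theorem polyOrdGE_lagrangeRescale_sub_truncation
    (z : MvPolynomial σ (LaurentSeries F)) {p : ℕ} (hz : PolyOrdGE (-(p : ℤ)) z) {d m : ℕ}
    (hm : p + 1 ≤ m) (lam : Fin (d + 1) → F) (hlam : Function.Injective lam)
    {t ℓ : Fin (d + 1) → LaurentSeries F} (ht : ∀ j, t j = HahnSeries.single (m : ℤ) (lam j))
    (hℓ : ∀ j, ℓ j = ∏ i ∈ univ.erase j, (1 - t i) / (t j - t i)) :
    PolyOrdGE 1 (∑ j, C (ℓ j) * aeval (fun b : σ => C (t j) * X b) z -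
      ∑ i ∈ range (d + 1), homogeneousComponent i z) := by
  classical
  have ht' : Function.Injective t := by
    intro j₁ j₂ h
    rw [ht, ht] at h
    exact hlam (HahnSeries.single_injective _ h)
  intro n
  simp only [coeff_sub, coeff_sum, coeff_C_mul, coeff_aeval_C_mul_X, coeff_homogeneousComponent,
    Finset.sum_ite_eq, Finset.mem_range]
  by_cases hnd : n.degree ≤ d
  · rw [if_pos (Nat.lt_succ_of_le hnd)]
    have hsum : ∑ j, ℓ j * (t j ^ n.degree * coeff n z) = coeff n z := by
      simp_rw [← mul_assoc]
      rw [← Finset.sum_mul, sum_lagrangeWeight_mul_pow ht' hℓ hnd, one_mul]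
    rw [hsum, sub_self]
    exact IsOrdGE.zero 1
  · rw [if_neg (by omega), sub_zero]
    refine IsOrdGE.sum fun j _ => ?_
    have hfac : ∀ i ∈ univ.erase j, IsOrdGE (-(m : ℤ)) ((1 - t i) / (t j - t i)) := by
      intro i hi
      have hij : i ≠ j := Finset.ne_of_mem_erase hi
      have hne : lam j - lam i ≠ 0 := sub_ne_zero.2 fun h => hij (hlam h).symm
      have hdiff : t j - t i = HahnSeries.single (m : ℤ) (lam j - lam i) := by
        rw [ht j, ht i, HahnSeries.single_sub]
      have h1 : IsOrdGE 0 (1 - t i) := by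
        rw [ht i]
        exact IsOrdGE.one.sub ((IsOrdGE.single _ _).mono (by omega))
      rw [div_eq_mul_inv, hdiff, HahnSeries.inv_single]
      simpa using h1.mul (IsOrdGE.single (-(m : ℤ)) (lam j - lam i)⁻¹)
    have hℓord : IsOrdGE ((d : ℤ) * (-(m : ℤ))) (ℓ j) := by
      have hcard : ((univ : Finset (Fin (d + 1))).erase j).card = d := by
        rw [Finset.card_erase_of_mem (Finset.mem_univ j), Finset.card_univ, Fintype.card_fin]
        rfl
      have := isOrdGE_prod _ hfac
      rw [hcard, ← hℓ j] at this
      exact this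
    have htord : IsOrdGE ((n.degree : ℤ) * (m : ℤ)) (t j ^ n.degree) := by
      rw [ht j]
      exact isOrdGE_pow (IsOrdGE.single _ _) _
    refine (hℓord.mul (htord.mul (hz n))).mono ?_
    have hN : (d : ℤ) + 1 ≤ n.degree := by exact_mod_cast Nat.succ_le_of_lt (Nat.lt_of_not_le hnd)
    have hm' : (p : ℤ) + 1 ≤ m := by exact_mod_cast hm
    nlinarith [mul_nonneg (sub_nonneg.2 hN) (show (0 : ℤ) ≤ m by positivity)]

end Lagrange
end Summit.ValiantsHypothesis.ValiantsHypothesis.Theorems.VPBoundarySquareRootsToolbox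
end
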